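import Summits.CriticalPhenomena.SAWScalingLimit.Theses.SAWIsotropicAnchor
import Literature.Probability.RandomPlanarGeometry.ConformalRestrictionProofs
import Literature.Probability.RandomPlanarGeometry.LatticeSimilarityCovariance
import Literature.Probability.Percolation.CLE6
import HarnessLib

/-!
# Line `split` — registered skeleton AND route-level split of the crux `AnchorAxiomsOfLimit`
# (stmt-CriticalPhenomena-7299; strategist, route SAWIsotropicAnchor): the three SOFT conjuncts are
# proved from the finite-`ℓ` exact symmetries of the anchor, the HARD conjuncts are the leaves

`AnchorAxiomsOfLimit` says: for every chordal family `P` that is the FULL scaling limit of the critical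
freely-jointed non-crossing chain `fjc ℓ Ω x y` (for every Dobrushin domain and every ADMISSIBLE endpoint
approximation, `(lim)`), given that every Dobrushin domain admits an admissible approximation (`(approx)`),

  (1) `P.IsRestrictionMarkov` · (2) `P.IsReversible` · (3) `P.IsSimilarityCovariant` ·
  (4) conjugation covariance · (5) a.s. simple curves meeting `∂D` only at the marked points.

The conjuncts are of two kinds. (2), (3), (4) are EXACT finite-`ℓ` symmetries of the chain law (reversal
swaps the start and target balls; Haar directions and the Lebesgue start ball are covariant under every
similarity `z ↦ c z + w`, with the step length — the mesh — multiplied by `‖c‖`; complex conjugation) plus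
uniqueness of weak limits along the proper filter `𝓝[>] 0`; NO estimate is involved in the passage. (1) and
(5) carry estimates (null boundary touching, slit-domain stability, no macroscopic self-touching).

This file therefore cuts the crux into FOUR pieces, typed as the route's split children

* `AnchorExactSymmetries` (X1) — the finite-`ℓ` identities of `fjc` (similarity / conjugation / reversal),
  a statement WITHOUT any limit in it (change of variables in the inlined configuration integral);
* `AnchorRestriction`     (X2) — `(approx) → (lim) → P.IsRestriction` (restriction passage);
* `AnchorMarkovKernel`    (X3) — `(approx) → (lim) → P.IsRestriction → (5) → P.IsRestrictionMarkov`
  (the restriction-coupled Markov kernel, built from slit-domain limits; fed X2 and X4);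
* `AnchorSimpleBoundary`  (X4) — `(approx) → (lim) → (5)`;

and PROVES the assembly `X1 → X2 → X3 → X4 → AnchorAxiomsOfLimit` (`AnchorAxiomsOfLimit_of`, no `sorry`
of its own): an identification principle for the anchor (`apply_eq_map_of_identity`: a finite-`ℓ` identity
`T_* F_{s(ℓ)}(D; a(sℓ), b(sℓ)) = F_ℓ(D'; a'(ℓ), b'(ℓ))` along a reparametrisation `s(ℓ) → 0⁺` of the mesh
identifies `P D' = T_* P D`, by `tendsto_nhds_unique` + `ext_of_forall_integral_eq_of_IsFiniteMeasure`),
admissibility transfer along plane homeomorphisms and along reversal (`adm_map`, `adm_swap`), and the three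
passages `isSimilarityCovariant_of_sym`, `conj_cov_of_sym`, `isReversible_of_sym` — all proved for an
ARBITRARY law family `F : ℝ → Set ℂ → ℂ → ℂ → Measure (CurveClass ℂ)` and then instantiated at the inlined
anchor law (named `fjc` below; the route decls are this file's generic statements at `F := fjc` by `rfl`).

The four children are ALSO the stubs of this line (`stub_anchorExactSymmetries`, `stub_anchorRestriction`,
`stub_anchorMarkovKernel`, `stub_anchorSimpleBoundary` — the ONLY `sorry`s of the file), and
`AnchorAxiomsOfLimit_of` fed with them concludes `SAWIsotropicAnchor.AnchorAxiomsOfLimit` BY NAME.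

References: G. F. Lawler, O. Schramm, W. Werner, *On the scaling limit of planar self-avoiding walk*
(2004), arXiv:math/0204277, §2.2 (symmetries of the limit), §3.1 (reversal), §3.4.2, §3.4.5;
P. Billingsley, *Convergence of probability measures*, 2nd ed. (1999), Thm 1.2 and Thm 2.7 (continuous
mapping); V. Beffara, *Is critical 2D percolation universal?* (2008), arXiv:0708.3908, §2.1. All [folklore].
-/

noncomputable section

open scoped BigOperators Topology Classical MeasureTheory ProbabilityTheory ComplexConjugate ContinuousMap
open MeasureTheory Filter Set Function TopologicalSpace
open Literature.Probability.LatticeModels Literature.Probability.RandomPlanarGeometry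

namespace Summit.CriticalPhenomena.SAWScalingLimit.Cruxes.AnchorAxiomsOfLimit.Split

/-! ### The anchor law, named (verbatim the `let fjc := …` inlined in every item of the route) -/

/-- **The critical freely-jointed non-crossing chain law** `fjc ℓ Ω x y` on curve classes: steps of
length `ℓ` with i.i.d. Haar directions, hard non-crossing, grand-canonical at the critical step fugacity
`1/μ_fjc`, started uniformly in `B(x, ℓ)`, stopped in `B(y, ℓ)`, confined to `cl Ω`, normalised
(verbatim the term inlined in `AnchorAxiomsOfLimit`). [cite: LawlerSchrammWerner2004SAW, §3.4.2] -/
def fjc : ℝ → Set ℂ → ℂ → ℂ → MeasureTheory.Measure (Literature.Probability.RandomPlanarGeometry.CurveClass ℂ) :=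
  fun ℓ Ω x y => (let S : (N : ℕ) → (Fin N → ℝ) → Fin (N + 1) → ℂ := fun N θ k => ∑ j : Fin N, if (j : ℕ) < (k : ℕ) then Complex.exp (Complex.I * (θ j : ℂ)) else 0; let C : (N : ℕ) → (Fin (N + 1) → ℂ) → Literature.Probability.RandomPlanarGeometry.CurveClass ℂ := fun _ v => Literature.Probability.RandomPlanarGeometry.CurveClass.mk ⟨Literature.Probability.LatticeModels.polyline (List.ofFn v)⟩; let Z : ℕ → ℝ := fun N => ((MeasureTheory.volume : MeasureTheory.Measure (Fin N → ℝ)) {θ | (∀ j, θ j ∈ Set.Ico (0 : ℝ) (2 * Real.pi)) ∧ C N (S N θ) ∈ Literature.Probability.RandomPlanarGeometry.CurveClass.simple}).toReal / (2 * Real.pi) ^ N; let μ : ℝ := ⨅ N : ℕ, Z (N + 1) ^ (1 / ((N : ℝ) + 1)); let V : (N : ℕ) → ℂ × (Fin N → ℝ) → Literature.Probability.RandomPlanarGeometry.CurveClass ℂ := fun N p => C N (fun k => p.1 + (ℓ : ℂ) * S N p.2 k); let E : Set (Literature.Probability.RandomPlanarGeometry.CurveClass ℂ) := {c | c ∈ Literature.Probability.RandomPlanarGeometry.CurveClass.simple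 ∧ c.range ⊆ closure Ω ∧ c.target ∈ Metric.ball y ℓ}; let W : MeasureTheory.Measure (Literature.Probability.RandomPlanarGeometry.CurveClass ℂ) := MeasureTheory.Measure.sum fun N : ℕ => ENNReal.ofReal ((μ⁻¹ / (2 * Real.pi)) ^ N) • ((((MeasureTheory.volume.restrict (Metric.ball x ℓ)).prod (MeasureTheory.volume.restrict (Set.univ.pi fun _ : Fin N => Set.Ico (0 : ℝ) (2 * Real.pi)))).restrict (V N ⁻¹' E)).map (V N)); (W Set.univ)⁻¹ • W)

/-! ### Generic vocabulary for a law family `F ℓ Ω x y` -/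

variable {F : ℝ → Set ℂ → ℂ → ℂ → Measure (CurveClass ℂ)} {P : ChordalFamily}

/-- **Admissible endpoint approximation** of the Dobrushin domain `D` for the law family `F`: interior
points `a' ℓ → a`, `b' ℓ → b` along `ℓ → 0⁺` with `F ℓ D a'(ℓ) b'(ℓ)` eventually a probability measure
(verbatim the clause inlined in the route items). [folklore] -/
def Adm (F : ℝ → Set ℂ → ℂ → ℂ → Measure (CurveClass ℂ)) (D : DobrushinDomain) (a' b' : ℝ → ℂ) : Prop :=
  Filter.Tendsto a' (nhdsWithin 0 (Set.Ioi 0)) (nhds (D.pt 0)) ∧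
    Filter.Tendsto b' (nhdsWithin 0 (Set.Ioi 0)) (nhds (D.pt 1)) ∧
      ∀ᶠ ℓ in nhdsWithin 0 (Set.Ioi 0), MeasureTheory.IsProbabilityMeasure (F ℓ D.carrier (a' ℓ) (b' ℓ))

/-- Every Dobrushin domain admits an admissible approximation (the clause `(approx)` of the crux =
the content of the support item `AnchorApproxExists`). [folklore] -/
def Approx (F : ℝ → Set ℂ → ℂ → ℂ → Measure (CurveClass ℂ)) : Prop :=
  ∀ D : DobrushinDomain, ∃ a' b' : ℝ → ℂ, Adm F D a' b'

/-- `P` is the FULL scaling limit of `F`: along every admissible approximation of every Dobrushin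
domain, `F ℓ D a'(ℓ) b'(ℓ) → P D` in law as `ℓ → 0⁺` (the clause `(lim)` of the crux). [folklore] -/
def Lim (F : ℝ → Set ℂ → ℂ → ℂ → Measure (CurveClass ℂ)) (P : ChordalFamily) : Prop :=
  ∀ (D : DobrushinDomain) (a' b' : ℝ → ℂ), Adm F D a' b' →
    TendstoLaw (fun (_ : ℝ) (c : CurveClass ℂ) => c) (fun ℓ => F ℓ D.carrier (a' ℓ) (b' ℓ)) id (P D)

/-- The simplicity / boundary-avoidance clause (5). [folklore] -/
def SimpleBd (P : ChordalFamily) : Prop :=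
  ∀ D : DobrushinDomain, ∀ᵐ γ ∂(P D), γ ∈ CurveClass.simple ∧ γ.range ∩ frontier D.carrier ⊆ {D.pt 0, D.pt 1}

/-- **Finite-`ℓ` exact symmetries** of a law family (the statement of child X1 at `F`): similarity
covariance with the mesh multiplied by `‖c‖`, conjugation covariance, reversal = swap of the endpoints.
[folklore] -/
def Sym (F : ℝ → Set ℂ → ℂ → ℂ → Measure (CurveClass ℂ)) : Prop :=
  (∀ (ℓ : ℝ) (Ω : Set ℂ) (x y c : ℂ) (hc : c ≠ 0) (w : ℂ), 0 < ℓ →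
      (F ℓ Ω x y).map (CurveClass.map (similarity c hc w : C(ℂ, ℂ))) =
        F (‖c‖ * ℓ) (similarity c hc w '' Ω) (similarity c hc w x) (similarity c hc w y)) ∧
    (∀ (ℓ : ℝ) (Ω : Set ℂ) (x y : ℂ), 0 < ℓ →
      (F ℓ Ω x y).map (CurveClass.map (Complex.conjLIE.toHomeomorph : C(ℂ, ℂ))) =
        F ℓ (Complex.conjLIE.toHomeomorph '' Ω) (Complex.conjLIE.toHomeomorph x)
          (Complex.conjLIE.toHomeomorph y)) ∧
    (∀ (ℓ : ℝ) (Ω : Set ℂ) (x y : ℂ), 0 < ℓ → (F ℓ Ω x y).map CurveClass.reverse = F ℓ Ω y x)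

/-- The conclusion of the crux at `P`: the five axioms consumed by `RStarRot`. [folklore] -/
def Axioms (P : ChordalFamily) : Prop :=
  P.IsRestrictionMarkov ∧ P.IsReversible ∧ P.IsSimilarityCovariant ∧
    (∀ D : DobrushinDomain, P (D.map Complex.conjLIE.toHomeomorph) =
      (P D).map (CurveClass.map (Complex.conjLIE.toHomeomorph : C(ℂ, ℂ)))) ∧ SimpleBd P

/-! ### Identification principle: a finite-`ℓ` identity along a reparametrised mesh identifies the limit -/

/-- **Identification principle for the anchor** (uniqueness of weak limits, Billingsley Thm 1.2, and the
continuous mapping theorem, Thm 2.7). Let `P` be chordal and the full limit of `F`. If `T` is a continuous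
self-map of curve space, `(a, b)` is admissible for `D`, `(a', b')` is admissible for `D'`, `s(ℓ) → 0⁺` as
`ℓ → 0⁺`, and eventually `T_* F_{s ℓ}(D; a (s ℓ), b (s ℓ)) = F_ℓ(D'; a' ℓ, b' ℓ)`, then `P D' = T_* (P D)`:
both sides are limits of the same test integrals along the proper filter `𝓝[>] 0`. [folklore] -/
theorem apply_eq_map_of_identity (hch : P.IsChordal) (hlim : Lim F P) {T : CurveClass ℂ → CurveClass ℂ}
    (hT : Continuous T) {D D' : DobrushinDomain} {a b a' b' : ℝ → ℂ} (hab : Adm F D a b)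
    (hab' : Adm F D' a' b') {s : ℝ → ℝ} (hs : Tendsto s (𝓝[>] (0 : ℝ)) (𝓝[>] (0 : ℝ)))
    (hid : ∀ᶠ ℓ in 𝓝[>] (0 : ℝ),
      (F (s ℓ) D.carrier (a (s ℓ)) (b (s ℓ))).map T = F ℓ D'.carrier (a' ℓ) (b' ℓ)) :
    P D' = (P D).map T := by
  haveI : IsProbabilityMeasure (P D) := (hch D).1
  haveI : IsProbabilityMeasure (P D') := (hch D').1
  refine ext_of_forall_integral_eq_of_IsFiniteMeasure fun f => ?_
  have h1 := hlim D' a' b' hab' f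
  have h2 := (hlim D a b hab (f.compContinuous ⟨T, hT⟩)).comp hs
  simp only [id, BoundedContinuousFunction.compContinuous_apply, ContinuousMap.coe_mk] at h1 h2
  rw [integral_map hT.measurable.aemeasurable f.continuous.aestronglyMeasurable]
  refine tendsto_nhds_unique (h1.congr' ?_) h2
  filter_upwards [hid] with ℓ hℓ
  simp only [Function.comp_apply]
  rw [← hℓ, integral_map hT.measurable.aemeasurable f.continuous.aestronglyMeasurable]

/-! ### Admissibility transfer -/

/-- Rescaling the mesh `ℓ ↦ ℓ / r` (`r > 0`) preserves the filter `ℓ → 0⁺`. [folklore] -/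
theorem tendsto_div_const_nhdsGT {r : ℝ} (hr : 0 < r) :
    Tendsto (fun ℓ : ℝ => ℓ / r) (𝓝[>] (0 : ℝ)) (𝓝[>] (0 : ℝ)) := by
  refine tendsto_nhdsWithin_iff.2 ⟨?_, ?_⟩
  · have h : Tendsto (fun ℓ : ℝ => ℓ / r) (𝓝 (0 : ℝ)) (𝓝 (0 / r)) := tendsto_id.div_const r
    rw [zero_div] at h
    exact h.mono_left nhdsWithin_le_nhds
  · filter_upwards [self_mem_nhdsWithin] with ℓ hℓ
    exact div_pos hℓ hr

/-- **Admissibility transfer along a plane homeomorphism with exact covariance of ratio `r`.** If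
`φ_* F_ℓ(Ω; x, y) = F_{rℓ}(φΩ; φx, φy)` for `ℓ > 0` and `(a, b)` is admissible for `D`, then
`ℓ ↦ (φ (a (ℓ/r)), φ (b (ℓ/r)))` is admissible for the image domain `φ D` (push-forwards of probability
measures along the Borel map `CurveClass.map φ` are probability measures). [folklore] -/
theorem adm_map (φ : ℂ ≃ₜ ℂ) {r : ℝ} (hr : 0 < r)
    (hid : ∀ (ℓ : ℝ) (Ω : Set ℂ) (x y : ℂ), 0 < ℓ →
      (F ℓ Ω x y).map (CurveClass.map (φ : C(ℂ, ℂ))) = F (r * ℓ) (φ '' Ω) (φ x) (φ y))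
    {D : DobrushinDomain} {a b : ℝ → ℂ} (hab : Adm F D a b) :
    Adm F (D.map φ) (fun ℓ => φ (a (ℓ / r))) (fun ℓ => φ (b (ℓ / r))) := by
  have hs := tendsto_div_const_nhdsGT hr
  refine ⟨?_, ?_, ?_⟩
  · rw [MarkedDomain.pt_map]
    exact (φ.continuous.tendsto _).comp (hab.1.comp hs)
  · rw [MarkedDomain.pt_map]
    exact (φ.continuous.tendsto _).comp (hab.2.1.comp hs)
  · filter_upwards [hs.eventually hab.2.2, self_mem_nhdsWithin] with ℓ hℓ hpos
    have key := hid (ℓ / r) D.carrier (a (ℓ / r)) (b (ℓ / r)) (div_pos hpos hr)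
    rw [mul_div_cancel₀ _ hr.ne'] at key
    rw [MarkedDomain.carrier_map, ← key]
    haveI := hℓ
    exact Measure.isProbabilityMeasure_map (CurveClass.measurable_map _).aemeasurable

/-- **Admissibility transfer along reversal.** If `reverse_* F_ℓ(Ω; x, y) = F_ℓ(Ω; y, x)` for `ℓ > 0`
and `(a, b)` is admissible for `D`, then `(b, a)` is admissible for every Dobrushin structure `D'` on the
same carrier with the marked points exchanged. [folklore] -/
theorem adm_swap
    (hid : ∀ (ℓ : ℝ) (Ω : Set ℂ) (x y : ℂ), 0 < ℓ → (F ℓ Ω x y).map CurveClass.reverse = F ℓ Ω y x)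
    {D D' : DobrushinDomain} (hc : D'.carrier = D.carrier) (h0 : D'.pt 0 = D.pt 1)
    (h1 : D'.pt 1 = D.pt 0) {a b : ℝ → ℂ} (hab : Adm F D a b) : Adm F D' b a := by
  refine ⟨?_, ?_, ?_⟩
  · rw [h0]
    exact hab.2.1
  · rw [h1]
    exact hab.1
  · filter_upwards [hab.2.2, self_mem_nhdsWithin] with ℓ hℓ hpos
    rw [hc, ← hid ℓ D.carrier (a ℓ) (b ℓ) hpos]
    haveI := hℓ
    exact Measure.isProbabilityMeasure_map CurveClass.measurable_reverse.aemeasurable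

/-! ### The three soft conjuncts: exact symmetry at every `ℓ` + uniqueness of weak limits -/

/-- **Covariance of the limit under a plane homeomorphism with exact finite-`ℓ` covariance.** If
`φ_* F_ℓ(Ω; x, y) = F_{rℓ}(φΩ; φx, φy)` (`r > 0`) at every `ℓ > 0`, then every chordal full limit `P` of
`F` satisfies `P (φ D) = φ_* (P D)`: through the transferred approximation the laws in `φ D` at mesh `ℓ`
ARE the images of the laws in `D` at mesh `ℓ / r`. [cite: LawlerSchrammWerner2004SAW, §2.2] -/
theorem cov_of_identity (hch : P.IsChordal) (happ : Approx F) (hlim : Lim F P) (φ : ℂ ≃ₜ ℂ) {r : ℝ}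
    (hr : 0 < r)
    (hid : ∀ (ℓ : ℝ) (Ω : Set ℂ) (x y : ℂ), 0 < ℓ →
      (F ℓ Ω x y).map (CurveClass.map (φ : C(ℂ, ℂ))) = F (r * ℓ) (φ '' Ω) (φ x) (φ y))
    (D : DobrushinDomain) :
    P (D.map φ) = (P D).map (CurveClass.map (φ : C(ℂ, ℂ))) := by
  obtain ⟨a, b, hab⟩ := happ D
  refine apply_eq_map_of_identity hch hlim (CurveClass.continuous_map _) hab (adm_map φ hr hid hab)
    (tendsto_div_const_nhdsGT hr) ?_
  filter_upwards [self_mem_nhdsWithin] with ℓ hℓ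
  have key := hid (ℓ / r) D.carrier (a (ℓ / r)) (b (ℓ / r)) (div_pos hℓ hr)
  rwa [mul_div_cancel₀ _ hr.ne'] at key

/-- **(3) Full similarity covariance of the limit** from the exact similarity covariance of the chain
(rotations EXACT — Haar directions —, translations exact — Lebesgue start ball —, dilations through the
scaling orbit `ℓ ↦ ‖c‖ ℓ`). [cite: LawlerSchrammWerner2004SAW, §2.2] -/
theorem isSimilarityCovariant_of_sym (hch : P.IsChordal) (happ : Approx F) (hlim : Lim F P)
    (hsym : Sym F) : P.IsSimilarityCovariant := fun D c hc w =>
  cov_of_identity hch happ hlim (similarity c hc w) (norm_pos_iff.2 hc)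
    (fun ℓ Ω x y hℓ => hsym.1 ℓ Ω x y c hc w hℓ) D

/-- **(4) Conjugation covariance of the limit** from the exact reflection symmetry of the chain.
[cite: Beffara2008Universal, §2.1] -/
theorem conj_cov_of_sym (hch : P.IsChordal) (happ : Approx F) (hlim : Lim F P) (hsym : Sym F)
    (D : DobrushinDomain) :
    P (D.map Complex.conjLIE.toHomeomorph) =
      (P D).map (CurveClass.map (Complex.conjLIE.toHomeomorph : C(ℂ, ℂ))) :=
  cov_of_identity hch happ hlim Complex.conjLIE.toHomeomorph one_pos
    (fun ℓ Ω x y hℓ => by rw [one_mul]; exact hsym.2.1 ℓ Ω x y hℓ) D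

/-- **(2) Reversibility of the limit** from the exact reversal symmetry of the chain (reversing the step
sequence is volume preserving and swaps the start and target balls): `P (D; b, a) = reverse_* P (D; a, b)`
for every Dobrushin structure with the marked points exchanged. [cite: LawlerSchrammWerner2004SAW, §3.1] -/
theorem isReversible_of_sym (hch : P.IsChordal) (happ : Approx F) (hlim : Lim F P) (hsym : Sym F) :
    P.IsReversible := by
  intro D D' hc h0 h1
  obtain ⟨a, b, hab⟩ := happ D
  refine apply_eq_map_of_identity hch hlim CurveClass.continuous_reverse hab
    (adm_swap hsym.2.2 hc h0 h1 hab) tendsto_id ?_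
  filter_upwards [self_mem_nhdsWithin] with ℓ hℓ
  rw [hc]
  exact hsym.2.2 ℓ D.carrier (a ℓ) (b ℓ) hℓ

/-! ### The generic assembly -/

/-- **The axioms of the limit from the four pieces, for an arbitrary law family `F`.** Soft conjuncts
(2), (3), (4) from the finite-`ℓ` symmetries `Sym F` by the identification principle; restriction from the
restriction piece; the Markov kernel from the kernel piece FED restriction and simplicity; simplicity from
the simplicity piece. [folklore] -/
theorem axioms_of_pieces (hsym : Sym F)
    (hres : ∀ P : ChordalFamily, P.IsChordal → Approx F → Lim F P → P.IsRestriction)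
    (hmk : ∀ P : ChordalFamily, P.IsChordal → Approx F → Lim F P → P.IsRestriction → SimpleBd P →
      P.IsRestrictionMarkov)
    (hsimple : ∀ P : ChordalFamily, P.IsChordal → Approx F → Lim F P → SimpleBd P)
    (P : ChordalFamily) (hch : P.IsChordal) (happ : Approx F) (hlim : Lim F P) : Axioms P := by
  -- (5) simplicity and boundary avoidance of the limit (piece X4)
  have hs : SimpleBd P := hsimple P hch happ hlim
  -- restriction of the limit (piece X2), fed with (5) into the kernel construction (piece X3): (1)
  have hr : P.IsRestriction := hres P hch happ hlim
  have hRM : P.IsRestrictionMarkov := hmk P hch happ hlim hr hs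
  -- (2), (3), (4): exact finite-`ℓ` symmetries (piece X1) + uniqueness of weak limits
  exact ⟨hRM, isReversible_of_sym hch happ hlim hsym, isSimilarityCovariant_of_sym hch happ hlim hsym,
    conj_cov_of_sym hch happ hlim hsym, hs⟩

/-! ### Bridges: the route decl and the four children ARE the generic statements at `F := fjc` -/

/-- `AnchorAxiomsOfLimit` unfolded: the generic axioms statement at the anchor law. [folklore] -/
theorem anchorAxiomsOfLimit_iff :
    Summit.CriticalPhenomena.SAWScalingLimit.Theses.SAWIsotropicAnchor.AnchorAxiomsOfLimit ↔
      ∀ P : ChordalFamily, P.IsChordal → Approx fjc → Lim fjc P → Axioms P :=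
  Iff.rfl

end Summit.CriticalPhenomena.SAWScalingLimit.Cruxes.AnchorAxiomsOfLimit.Split

/-! ### The stubs of the line `split` (the ONLY `sorry`s of this file) = the four split children, verbatim -/

namespace Summit.CriticalPhenomena.SAWScalingLimit.Cruxes.AnchorAxiomsOfLimit.Split

/-- **Stub = child X1 `AnchorExactSymmetries`**: the finite-`ℓ` exact identities of the anchor law —
similarity covariance `φ_* fjc ℓ Ω x y = fjc (‖c‖ℓ) (φΩ) (φx) (φy)` for `φ z = c z + w`, conjugation
covariance, reversal `reverse_* fjc ℓ Ω x y = fjc ℓ Ω y x` (change of variables in the configuration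
integral: Haar directions, Lebesgue start ball, the target ball and the confinement/simplicity event are
covariant; the connective constant `μ_fjc` does not depend on `ℓ`; normalisation absorbs the Jacobian
`‖c‖²`). [cite: LawlerSchrammWerner2004SAW, §3.1 and §2.2] -/
theorem stub_anchorExactSymmetries :
    let fjc : ℝ → Set ℂ → ℂ → ℂ → MeasureTheory.Measure (Literature.Probability.RandomPlanarGeometry.CurveClass ℂ) := fun ℓ Ω x y => (let S : (N : ℕ) → (Fin N → ℝ) → Fin (N + 1) → ℂ := fun N θ k => ∑ j : Fin N, if (j : ℕ) < (k : ℕ) then Complex.exp (Complex.I * (θ j : ℂ)) else 0; let C : (N : ℕ) → (Fin (N + 1) → ℂ) → Literature.Probability.RandomPlanarGeometry.CurveClass ℂ := fun _ v => Literature.Probability.RandomPlanarGeometry.CurveClass.mk ⟨Literature.Probability.LatticeModels.polyline (List.ofFn v)⟩; let Z : ℕ → ℝ := fun N => ((MeasureTheory.volume : MeasureTheory.Measure (Fin N → ℝ)) {θ | (∀ j, θ j ∈ Set.Ico (0 : ℝ) (2 * Real.pi)) ∧ C N (S N θ) ∈ Literature.Probability.RandomPlanarGeometry.CurveClass.simple}).toReal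 / (2 * Real.pi) ^ N; let μ : ℝ := ⨅ N : ℕ, Z (N + 1) ^ (1 / ((N : ℝ) + 1)); let V : (N : ℕ) → ℂ × (Fin N → ℝ) → Literature.Probability.RandomPlanarGeometry.CurveClass ℂ := fun N p => C N (fun k => p.1 + (ℓ : ℂ) * S N p.2 k); let E : Set (Literature.Probability.RandomPlanarGeometry.CurveClass ℂ) := {c | c ∈ Literature.Probability.RandomPlanarGeometry.CurveClass.simple ∧ c.range ⊆ closure Ω ∧ c.target ∈ Metric.ball y ℓ}; let W : MeasureTheory.Measure (Literature.Probability.RandomPlanarGeometry.CurveClass ℂ) := MeasureTheory.Measure.sum fun N : ℕ => ENNReal.ofReal ((μ⁻¹ / (2 * Real.pi)) ^ N) • ((((MeasureTheory.volume.restrict (Metric.ball x ℓ)).prod (MeasureTheory.volume.restrict (Set.univ.pi fun _ : Fin N => Set.Ico (0 : ℝ) (2 * Real.pi)))).restrict (V N ⁻¹' E)).map (V N)); (W Set.univ)⁻¹ • W); (∀ (ℓ : ℝ) (Ω : Set ℂ) (x y c : ℂ) (hc : c ≠ 0) (w : ℂ), 0 < ℓ → (fjc ℓ Ω x y).map (Literature.Probability.RandomPlanarGeometry.CurveClass.map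 (Literature.Probability.RandomPlanarGeometry.similarity c hc w : C(ℂ, ℂ))) = fjc (‖c‖ * ℓ) (Literature.Probability.RandomPlanarGeometry.similarity c hc w '' Ω) (Literature.Probability.RandomPlanarGeometry.similarity c hc w x) (Literature.Probability.RandomPlanarGeometry.similarity c hc w y)) ∧ (∀ (ℓ : ℝ) (Ω : Set ℂ) (x y : ℂ), 0 < ℓ → (fjc ℓ Ω x y).map (Literature.Probability.RandomPlanarGeometry.CurveClass.map (Complex.conjLIE.toHomeomorph : C(ℂ, ℂ))) = fjc ℓ (Complex.conjLIE.toHomeomorph '' Ω) (Complex.conjLIE.toHomeomorph x) (Complex.conjLIE.toHomeomorph y)) ∧ (∀ (ℓ : ℝ) (Ω : Set ℂ) (x y : ℂ), 0 < ℓ → (fjc ℓ Ω x y).map Literature.Probability.RandomPlanarGeometry.CurveClass.reverse = fjc ℓ Ω y x) := by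
  sorry

/-- **Stub = child X2 `AnchorRestriction`**: restriction passes to every full limit of the anchor
(conditioning identity `fjc ℓ Ω' x y = fjc ℓ Ω x y (· | range ⊆ cl Ω')` exact at each `ℓ`; the content is
no loss of avoidance mass / null touching of `cl(∂D' ∩ D)` by the limit). [cite: LawlerSchrammWerner2004SAW, §3.4.5] -/
theorem stub_anchorRestriction :
    let fjc : ℝ → Set ℂ → ℂ → ℂ → MeasureTheory.Measure (Literature.Probability.RandomPlanarGeometry.CurveClass ℂ) := fun ℓ Ω x y => (let S : (N : ℕ) → (Fin N → ℝ) → Fin (N + 1) → ℂ := fun N θ k => ∑ j : Fin N, if (j : ℕ) < (k : ℕ) then Complex.exp (Complex.I * (θ j : ℂ)) else 0; let C : (N : ℕ) → (Fin (N + 1) → ℂ) → Literature.Probability.RandomPlanarGeometry.CurveClass ℂ := fun _ v => Literature.Probability.RandomPlanarGeometry.CurveClass.mk ⟨Literature.Probability.LatticeModels.polyline (List.ofFn v)⟩; let Z : ℕ → ℝ := fun N => ((MeasureTheory.volume : MeasureTheory.Measure (Fin N → ℝ)) {θ | (∀ j, θ j ∈ Set.Ico (0 : ℝ) (2 * Real.pi))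 ∧ C N (S N θ) ∈ Literature.Probability.RandomPlanarGeometry.CurveClass.simple}).toReal / (2 * Real.pi) ^ N; let μ : ℝ := ⨅ N : ℕ, Z (N + 1) ^ (1 / ((N : ℝ) + 1)); let V : (N : ℕ) → ℂ × (Fin N → ℝ) → Literature.Probability.RandomPlanarGeometry.CurveClass ℂ := fun N p => C N (fun k => p.1 + (ℓ : ℂ) * S N p.2 k); let E : Set (Literature.Probability.RandomPlanarGeometry.CurveClass ℂ) := {c | c ∈ Literature.Probability.RandomPlanarGeometry.CurveClass.simple ∧ c.range ⊆ closure Ω ∧ c.target ∈ Metric.ball y ℓ}; let W : MeasureTheory.Measure (Literature.Probability.RandomPlanarGeometry.CurveClass ℂ) := MeasureTheory.Measure.sum fun N : ℕ => ENNReal.ofReal ((μ⁻¹ / (2 * Real.pi)) ^ N) • ((((MeasureTheory.volume.restrict (Metric.ball x ℓ)).prod (MeasureTheory.volume.restrict (Set.univ.pi fun _ : Fin N => Set.Ico (0 : ℝ) (2 * Real.pi)))).restrict (V N ⁻¹' E)).map (V N)); (W Set.univ)⁻¹ • W); ∀ P : Literature.Probability.RandomPlanarGeometry.ChordalFamily,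 P.IsChordal → (∀ D : Literature.Probability.RandomPlanarGeometry.DobrushinDomain, ∃ a' b' : ℝ → ℂ, (Filter.Tendsto a' (nhdsWithin 0 (Set.Ioi 0)) (nhds (D.pt 0)) ∧ Filter.Tendsto b' (nhdsWithin 0 (Set.Ioi 0)) (nhds (D.pt 1)) ∧ ∀ᶠ ℓ in nhdsWithin 0 (Set.Ioi 0), MeasureTheory.IsProbabilityMeasure (fjc ℓ D.carrier (a' ℓ) (b' ℓ)))) → (∀ (D : Literature.Probability.RandomPlanarGeometry.DobrushinDomain) (a' b' : ℝ → ℂ), (Filter.Tendsto a' (nhdsWithin 0 (Set.Ioi 0)) (nhds (D.pt 0)) ∧ Filter.Tendsto b' (nhdsWithin 0 (Set.Ioi 0)) (nhds (D.pt 1)) ∧ ∀ᶠ ℓ in nhdsWithin 0 (Set.Ioi 0), MeasureTheory.IsProbabilityMeasure (fjc ℓ D.carrier (a' ℓ) (b' ℓ))) → Literature.Probability.RandomPlanarGeometry.TendstoLaw (fun (_ : ℝ) (c : Literature.Probability.RandomPlanarGeometry.CurveClass ℂ) => c) (fun ℓ => fjc ℓ D.carrier (a' ℓ) (b' ℓ))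 id (P D)) → P.IsRestriction := by
  sorry

/-- **Stub = child X3 `AnchorMarkovKernel` (HARDEST)**: given restriction and simplicity, every full
limit of the anchor admits a restriction-coupled domain-Markov kernel (the chain is Markov in its tip at
step times; the kernel is the limit of the chain in SLIT domains, which must be stable under perturbation
of the slit near the tip). [cite: LawlerSchrammWerner2004SAW, §2.3] -/
theorem stub_anchorMarkovKernel :
    let fjc : ℝ → Set ℂ → ℂ → ℂ → MeasureTheory.Measure (Literature.Probability.RandomPlanarGeometry.CurveClass ℂ) := fun ℓ Ω x y => (let S : (N : ℕ) → (Fin N → ℝ) → Fin (N + 1) → ℂ := fun N θ k => ∑ j : Fin N, if (j : ℕ) < (k : ℕ) then Complex.exp (Complex.I * (θ j : ℂ)) else 0; let C : (N : ℕ) → (Fin (N + 1) → ℂ) → Literature.Probability.RandomPlanarGeometry.CurveClass ℂ := fun _ v => Literature.Probability.RandomPlanarGeometry.CurveClass.mk ⟨Literature.Probability.LatticeModels.polyline (List.ofFn v)⟩; let Z : ℕ → ℝ := fun N => ((MeasureTheory.volume : MeasureTheory.Measure (Fin N → ℝ)) {θ | (∀ j, θ j ∈ Set.Ico (0 : ℝ)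 (2 * Real.pi)) ∧ C N (S N θ) ∈ Literature.Probability.RandomPlanarGeometry.CurveClass.simple}).toReal / (2 * Real.pi) ^ N; let μ : ℝ := ⨅ N : ℕ, Z (N + 1) ^ (1 / ((N : ℝ) + 1)); let V : (N : ℕ) → ℂ × (Fin N → ℝ) → Literature.Probability.RandomPlanarGeometry.CurveClass ℂ := fun N p => C N (fun k => p.1 + (ℓ : ℂ) * S N p.2 k); let E : Set (Literature.Probability.RandomPlanarGeometry.CurveClass ℂ) := {c | c ∈ Literature.Probability.RandomPlanarGeometry.CurveClass.simple ∧ c.range ⊆ closure Ω ∧ c.target ∈ Metric.ball y ℓ}; let W : MeasureTheory.Measure (Literature.Probability.RandomPlanarGeometry.CurveClass ℂ) := MeasureTheory.Measure.sum fun N : ℕ => ENNReal.ofReal ((μ⁻¹ / (2 * Real.pi)) ^ N) • ((((MeasureTheory.volume.restrict (Metric.ball x ℓ)).prod (MeasureTheory.volume.restrict (Set.univ.pi fun _ : Fin N => Set.Ico (0 : ℝ) (2 * Real.pi)))).restrict (V N ⁻¹' E)).map (V N)); (W Set.univ)⁻¹ • W); ∀ P : Literature.Probability.RandomPlanarGeometry.ChordalFamily,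 P.IsChordal → (∀ D : Literature.Probability.RandomPlanarGeometry.DobrushinDomain, ∃ a' b' : ℝ → ℂ, (Filter.Tendsto a' (nhdsWithin 0 (Set.Ioi 0)) (nhds (D.pt 0)) ∧ Filter.Tendsto b' (nhdsWithin 0 (Set.Ioi 0)) (nhds (D.pt 1)) ∧ ∀ᶠ ℓ in nhdsWithin 0 (Set.Ioi 0), MeasureTheory.IsProbabilityMeasure (fjc ℓ D.carrier (a' ℓ) (b' ℓ)))) → (∀ (D : Literature.Probability.RandomPlanarGeometry.DobrushinDomain) (a' b' : ℝ → ℂ), (Filter.Tendsto a' (nhdsWithin 0 (Set.Ioi 0)) (nhds (D.pt 0)) ∧ Filter.Tendsto b' (nhdsWithin 0 (Set.Ioi 0)) (nhds (D.pt 1)) ∧ ∀ᶠ ℓ in nhdsWithin 0 (Set.Ioi 0), MeasureTheory.IsProbabilityMeasure (fjc ℓ D.carrier (a' ℓ) (b' ℓ))) → Literature.Probability.RandomPlanarGeometry.TendstoLaw (fun (_ : ℝ) (c : Literature.Probability.RandomPlanarGeometry.CurveClass ℂ) => c) (fun ℓ => fjc ℓ D.carrier (a' ℓ) (b' ℓ))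 id (P D)) → P.IsRestriction → (∀ D : Literature.Probability.RandomPlanarGeometry.DobrushinDomain, ∀ᵐ γ ∂(P D), γ ∈ Literature.Probability.RandomPlanarGeometry.CurveClass.simple ∧ γ.range ∩ frontier D.carrier ⊆ {D.pt 0, D.pt 1}) → P.IsRestrictionMarkov := by
  sorry

/-- **Stub = child X4 `AnchorSimpleBoundary`**: every full limit of the anchor is carried by simple
curves meeting `∂D` only at the marked points (uniform no-macroscopic-self-touching and no-boundary-crawling
bounds for the critical chain; no Kesten-pattern / DCH13 analogue off-lattice is in print).
[cite: LawlerSchrammWerner2004SAW, §3.4.5] -/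
theorem stub_anchorSimpleBoundary :
    let fjc : ℝ → Set ℂ → ℂ → ℂ → MeasureTheory.Measure (Literature.Probability.RandomPlanarGeometry.CurveClass ℂ) := fun ℓ Ω x y => (let S : (N : ℕ) → (Fin N → ℝ) → Fin (N + 1) → ℂ := fun N θ k => ∑ j : Fin N, if (j : ℕ) < (k : ℕ) then Complex.exp (Complex.I * (θ j : ℂ)) else 0; let C : (N : ℕ) → (Fin (N + 1) → ℂ) → Literature.Probability.RandomPlanarGeometry.CurveClass ℂ := fun _ v => Literature.Probability.RandomPlanarGeometry.CurveClass.mk ⟨Literature.Probability.LatticeModels.polyline (List.ofFn v)⟩; let Z : ℕ → ℝ := fun N => ((MeasureTheory.volume : MeasureTheory.Measure (Fin N → ℝ)) {θ | (∀ j, θ j ∈ Set.Ico (0 : ℝ) (2 * Real.pi)) ∧ C N (S N θ) ∈ Literature.Probability.RandomPlanarGeometry.CurveClass.simple}).toReal / (2 * Real.pi) ^ N; let μ : ℝ := ⨅ N : ℕ, Z (N + 1) ^ (1 / ((N : ℝ) + 1)); let V : (N : ℕ) → ℂ × (Fin N → ℝ) → Literature.Probability.RandomPlanarGeometry.CurveClass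 ℂ := fun N p => C N (fun k => p.1 + (ℓ : ℂ) * S N p.2 k); let E : Set (Literature.Probability.RandomPlanarGeometry.CurveClass ℂ) := {c | c ∈ Literature.Probability.RandomPlanarGeometry.CurveClass.simple ∧ c.range ⊆ closure Ω ∧ c.target ∈ Metric.ball y ℓ}; let W : MeasureTheory.Measure (Literature.Probability.RandomPlanarGeometry.CurveClass ℂ) := MeasureTheory.Measure.sum fun N : ℕ => ENNReal.ofReal ((μ⁻¹ / (2 * Real.pi)) ^ N) • ((((MeasureTheory.volume.restrict (Metric.ball x ℓ)).prod (MeasureTheory.volume.restrict (Set.univ.pi fun _ : Fin N => Set.Ico (0 : ℝ) (2 * Real.pi)))).restrict (V N ⁻¹' E)).map (V N)); (W Set.univ)⁻¹ • W); ∀ P : Literature.Probability.RandomPlanarGeometry.ChordalFamily, P.IsChordal → (∀ D : Literature.Probability.RandomPlanarGeometry.DobrushinDomain, ∃ a' b' : ℝ → ℂ, (Filter.Tendsto a' (nhdsWithin 0 (Set.Ioi 0)) (nhds (D.pt 0)) ∧ Filter.Tendsto b' (nhdsWithin 0 (Set.Ioi 0)) (nhds (D.pt 1)) ∧ ∀ᶠ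 ℓ in nhdsWithin 0 (Set.Ioi 0), MeasureTheory.IsProbabilityMeasure (fjc ℓ D.carrier (a' ℓ) (b' ℓ)))) → (∀ (D : Literature.Probability.RandomPlanarGeometry.DobrushinDomain) (a' b' : ℝ → ℂ), (Filter.Tendsto a' (nhdsWithin 0 (Set.Ioi 0)) (nhds (D.pt 0)) ∧ Filter.Tendsto b' (nhdsWithin 0 (Set.Ioi 0)) (nhds (D.pt 1)) ∧ ∀ᶠ ℓ in nhdsWithin 0 (Set.Ioi 0), MeasureTheory.IsProbabilityMeasure (fjc ℓ D.carrier (a' ℓ) (b' ℓ))) → Literature.Probability.RandomPlanarGeometry.TendstoLaw (fun (_ : ℝ) (c : Literature.Probability.RandomPlanarGeometry.CurveClass ℂ) => c) (fun ℓ => fjc ℓ D.carrier (a' ℓ) (b' ℓ)) id (P D)) → ∀ D : Literature.Probability.RandomPlanarGeometry.DobrushinDomain, ∀ᵐ γ ∂(P D), γ ∈ Literature.Probability.RandomPlanarGeometry.CurveClass.simple ∧ γ.range ∩ frontier D.carrier ⊆ {D.pt 0, D.pt 1} := by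
  sorry

/-! ### Name-keyed aliases of the stub statements -/

/-- The statement of `stub_anchorExactSymmetries`, as a `Prop` (= child X1 verbatim). -/
def AnchorExactSymmetriesStmt : Prop :=
  let fjc : ℝ → Set ℂ → ℂ → ℂ → MeasureTheory.Measure (Literature.Probability.RandomPlanarGeometry.CurveClass ℂ) := fun ℓ Ω x y => (let S : (N : ℕ) → (Fin N → ℝ) → Fin (N + 1) → ℂ := fun N θ k => ∑ j : Fin N, if (j : ℕ) < (k : ℕ) then Complex.exp (Complex.I * (θ j : ℂ)) else 0; let C : (N : ℕ) → (Fin (N + 1) → ℂ) → Literature.Probability.RandomPlanarGeometry.CurveClass ℂ := fun _ v => Literature.Probability.RandomPlanarGeometry.CurveClass.mk ⟨Literature.Probability.LatticeModels.polyline (List.ofFn v)⟩; let Z : ℕ → ℝ := fun N => ((MeasureTheory.volume : MeasureTheory.Measure (Fin N → ℝ)) {θ | (∀ j, θ j ∈ Set.Ico (0 : ℝ) (2 * Real.pi)) ∧ C N (S N θ) ∈ Literature.Probability.RandomPlanarGeometry.CurveClass.simple}).toReal / (2 * Real.pi) ^ N; let μ : ℝ := ⨅ N : ℕ, Z (N +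 1) ^ (1 / ((N : ℝ) + 1)); let V : (N : ℕ) → ℂ × (Fin N → ℝ) → Literature.Probability.RandomPlanarGeometry.CurveClass ℂ := fun N p => C N (fun k => p.1 + (ℓ : ℂ) * S N p.2 k); let E : Set (Literature.Probability.RandomPlanarGeometry.CurveClass ℂ) := {c | c ∈ Literature.Probability.RandomPlanarGeometry.CurveClass.simple ∧ c.range ⊆ closure Ω ∧ c.target ∈ Metric.ball y ℓ}; let W : MeasureTheory.Measure (Literature.Probability.RandomPlanarGeometry.CurveClass ℂ) := MeasureTheory.Measure.sum fun N : ℕ => ENNReal.ofReal ((μ⁻¹ / (2 * Real.pi)) ^ N) • ((((MeasureTheory.volume.restrict (Metric.ball x ℓ)).prod (MeasureTheory.volume.restrict (Set.univ.pi fun _ : Fin N => Set.Ico (0 : ℝ) (2 * Real.pi)))).restrict (V N ⁻¹' E)).map (V N)); (W Set.univ)⁻¹ • W); (∀ (ℓ : ℝ) (Ω : Set ℂ) (x y c : ℂ) (hc : c ≠ 0) (w : ℂ), 0 < ℓ → (fjc ℓ Ω x y).map (Literature.Probability.RandomPlanarGeometry.CurveClass.map (Literature.Probability.RandomPlanarGeometry.similarity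 c hc w : C(ℂ, ℂ))) = fjc (‖c‖ * ℓ) (Literature.Probability.RandomPlanarGeometry.similarity c hc w '' Ω) (Literature.Probability.RandomPlanarGeometry.similarity c hc w x) (Literature.Probability.RandomPlanarGeometry.similarity c hc w y)) ∧ (∀ (ℓ : ℝ) (Ω : Set ℂ) (x y : ℂ), 0 < ℓ → (fjc ℓ Ω x y).map (Literature.Probability.RandomPlanarGeometry.CurveClass.map (Complex.conjLIE.toHomeomorph : C(ℂ, ℂ))) = fjc ℓ (Complex.conjLIE.toHomeomorph '' Ω) (Complex.conjLIE.toHomeomorph x) (Complex.conjLIE.toHomeomorph y)) ∧ (∀ (ℓ : ℝ) (Ω : Set ℂ) (x y : ℂ), 0 < ℓ → (fjc ℓ Ω x y).map Literature.Probability.RandomPlanarGeometry.CurveClass.reverse = fjc ℓ Ω y x)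

/-- The statement of `stub_anchorRestriction`, as a `Prop` (= child X2 verbatim). -/
def AnchorRestrictionStmt : Prop :=
  let fjc : ℝ → Set ℂ → ℂ → ℂ → MeasureTheory.Measure (Literature.Probability.RandomPlanarGeometry.CurveClass ℂ) := fun ℓ Ω x y => (let S : (N : ℕ) → (Fin N → ℝ) → Fin (N + 1) → ℂ := fun N θ k => ∑ j : Fin N, if (j : ℕ) < (k : ℕ) then Complex.exp (Complex.I * (θ j : ℂ)) else 0; let C : (N : ℕ) → (Fin (N + 1) → ℂ) → Literature.Probability.RandomPlanarGeometry.CurveClass ℂ := fun _ v => Literature.Probability.RandomPlanarGeometry.CurveClass.mk ⟨Literature.Probability.LatticeModels.polyline (List.ofFn v)⟩; let Z : ℕ → ℝ := fun N => ((MeasureTheory.volume : MeasureTheory.Measure (Fin N → ℝ)) {θ | (∀ j, θ j ∈ Set.Ico (0 : ℝ) (2 * Real.pi)) ∧ C N (S N θ) ∈ Literature.Probability.RandomPlanarGeometry.CurveClass.simple}).toReal / (2 * Real.pi) ^ N; let μ : ℝ := ⨅ N : ℕ, Z (N + 1) ^ (1 / ((N : ℝ) + 1)); let V : (N : ℕ)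 → ℂ × (Fin N → ℝ) → Literature.Probability.RandomPlanarGeometry.CurveClass ℂ := fun N p => C N (fun k => p.1 + (ℓ : ℂ) * S N p.2 k); let E : Set (Literature.Probability.RandomPlanarGeometry.CurveClass ℂ) := {c | c ∈ Literature.Probability.RandomPlanarGeometry.CurveClass.simple ∧ c.range ⊆ closure Ω ∧ c.target ∈ Metric.ball y ℓ}; let W : MeasureTheory.Measure (Literature.Probability.RandomPlanarGeometry.CurveClass ℂ) := MeasureTheory.Measure.sum fun N : ℕ => ENNReal.ofReal ((μ⁻¹ / (2 * Real.pi)) ^ N) • ((((MeasureTheory.volume.restrict (Metric.ball x ℓ)).prod (MeasureTheory.volume.restrict (Set.univ.pi fun _ : Fin N => Set.Ico (0 : ℝ) (2 * Real.pi)))).restrict (V N ⁻¹' E)).map (V N)); (W Set.univ)⁻¹ • W); ∀ P : Literature.Probability.RandomPlanarGeometry.ChordalFamily, P.IsChordal → (∀ D : Literature.Probability.RandomPlanarGeometry.DobrushinDomain, ∃ a' b' : ℝ → ℂ, (Filter.Tendsto a' (nhdsWithin 0 (Set.Ioi 0)) (nhds (D.pt 0)) ∧ Filter.Tendsto b' (nhdsWithin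 0 (Set.Ioi 0)) (nhds (D.pt 1)) ∧ ∀ᶠ ℓ in nhdsWithin 0 (Set.Ioi 0), MeasureTheory.IsProbabilityMeasure (fjc ℓ D.carrier (a' ℓ) (b' ℓ)))) → (∀ (D : Literature.Probability.RandomPlanarGeometry.DobrushinDomain) (a' b' : ℝ → ℂ), (Filter.Tendsto a' (nhdsWithin 0 (Set.Ioi 0)) (nhds (D.pt 0)) ∧ Filter.Tendsto b' (nhdsWithin 0 (Set.Ioi 0)) (nhds (D.pt 1)) ∧ ∀ᶠ ℓ in nhdsWithin 0 (Set.Ioi 0), MeasureTheory.IsProbabilityMeasure (fjc ℓ D.carrier (a' ℓ) (b' ℓ))) → Literature.Probability.RandomPlanarGeometry.TendstoLaw (fun (_ : ℝ) (c : Literature.Probability.RandomPlanarGeometry.CurveClass ℂ) => c) (fun ℓ => fjc ℓ D.carrier (a' ℓ) (b' ℓ)) id (P D)) → P.IsRestriction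

/-- The statement of `stub_anchorMarkovKernel`, as a `Prop` (= child X3 verbatim). -/
def AnchorMarkovKernelStmt : Prop :=
  let fjc : ℝ → Set ℂ → ℂ → ℂ → MeasureTheory.Measure (Literature.Probability.RandomPlanarGeometry.CurveClass ℂ) := fun ℓ Ω x y => (let S : (N : ℕ) → (Fin N → ℝ) → Fin (N + 1) → ℂ := fun N θ k => ∑ j : Fin N, if (j : ℕ) < (k : ℕ) then Complex.exp (Complex.I * (θ j : ℂ)) else 0; let C : (N : ℕ) → (Fin (N + 1) → ℂ) → Literature.Probability.RandomPlanarGeometry.CurveClass ℂ := fun _ v => Literature.Probability.RandomPlanarGeometry.CurveClass.mk ⟨Literature.Probability.LatticeModels.polyline (List.ofFn v)⟩; let Z : ℕ → ℝ := fun N => ((MeasureTheory.volume : MeasureTheory.Measure (Fin N → ℝ)) {θ | (∀ j, θ j ∈ Set.Ico (0 : ℝ) (2 * Real.pi)) ∧ C N (S N θ) ∈ Literature.Probability.RandomPlanarGeometry.CurveClass.simple}).toReal / (2 * Real.pi) ^ N; let μ : ℝ := ⨅ N : ℕ, Z (N + 1) ^ (1 / ((N : ℝ) + 1)); let V : (N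 : ℕ) → ℂ × (Fin N → ℝ) → Literature.Probability.RandomPlanarGeometry.CurveClass ℂ := fun N p => C N (fun k => p.1 + (ℓ : ℂ) * S N p.2 k); let E : Set (Literature.Probability.RandomPlanarGeometry.CurveClass ℂ) := {c | c ∈ Literature.Probability.RandomPlanarGeometry.CurveClass.simple ∧ c.range ⊆ closure Ω ∧ c.target ∈ Metric.ball y ℓ}; let W : MeasureTheory.Measure (Literature.Probability.RandomPlanarGeometry.CurveClass ℂ) := MeasureTheory.Measure.sum fun N : ℕ => ENNReal.ofReal ((μ⁻¹ / (2 * Real.pi)) ^ N) • ((((MeasureTheory.volume.restrict (Metric.ball x ℓ)).prod (MeasureTheory.volume.restrict (Set.univ.pi fun _ : Fin N => Set.Ico (0 : ℝ) (2 * Real.pi)))).restrict (V N ⁻¹' E)).map (V N)); (W Set.univ)⁻¹ • W); ∀ P : Literature.Probability.RandomPlanarGeometry.ChordalFamily, P.IsChordal → (∀ D : Literature.Probability.RandomPlanarGeometry.DobrushinDomain, ∃ a' b' : ℝ → ℂ, (Filter.Tendsto a' (nhdsWithin 0 (Set.Ioi 0)) (nhds (D.pt 0)) ∧ Filter.Tendsto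 b' (nhdsWithin 0 (Set.Ioi 0)) (nhds (D.pt 1)) ∧ ∀ᶠ ℓ in nhdsWithin 0 (Set.Ioi 0), MeasureTheory.IsProbabilityMeasure (fjc ℓ D.carrier (a' ℓ) (b' ℓ)))) → (∀ (D : Literature.Probability.RandomPlanarGeometry.DobrushinDomain) (a' b' : ℝ → ℂ), (Filter.Tendsto a' (nhdsWithin 0 (Set.Ioi 0)) (nhds (D.pt 0)) ∧ Filter.Tendsto b' (nhdsWithin 0 (Set.Ioi 0)) (nhds (D.pt 1)) ∧ ∀ᶠ ℓ in nhdsWithin 0 (Set.Ioi 0), MeasureTheory.IsProbabilityMeasure (fjc ℓ D.carrier (a' ℓ) (b' ℓ))) → Literature.Probability.RandomPlanarGeometry.TendstoLaw (fun (_ : ℝ) (c : Literature.Probability.RandomPlanarGeometry.CurveClass ℂ) => c) (fun ℓ => fjc ℓ D.carrier (a' ℓ) (b' ℓ)) id (P D)) → P.IsRestriction → (∀ D : Literature.Probability.RandomPlanarGeometry.DobrushinDomain, ∀ᵐ γ ∂(P D), γ ∈ Literature.Probability.RandomPlanarGeometry.CurveClass.simple ∧ γ.range ∩ frontier D.carrier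 ⊆ {D.pt 0, D.pt 1}) → P.IsRestrictionMarkov

/-- The statement of `stub_anchorSimpleBoundary`, as a `Prop` (= child X4 verbatim). -/
def AnchorSimpleBoundaryStmt : Prop :=
  let fjc : ℝ → Set ℂ → ℂ → ℂ → MeasureTheory.Measure (Literature.Probability.RandomPlanarGeometry.CurveClass ℂ) := fun ℓ Ω x y => (let S : (N : ℕ) → (Fin N → ℝ) → Fin (N + 1) → ℂ := fun N θ k => ∑ j : Fin N, if (j : ℕ) < (k : ℕ) then Complex.exp (Complex.I * (θ j : ℂ)) else 0; let C : (N : ℕ) → (Fin (N + 1) → ℂ) → Literature.Probability.RandomPlanarGeometry.CurveClass ℂ := fun _ v => Literature.Probability.RandomPlanarGeometry.CurveClass.mk ⟨Literature.Probability.LatticeModels.polyline (List.ofFn v)⟩; let Z : ℕ → ℝ := fun N => ((MeasureTheory.volume : MeasureTheory.Measure (Fin N → ℝ)) {θ | (∀ j, θ j ∈ Set.Ico (0 : ℝ) (2 * Real.pi)) ∧ C N (S N θ) ∈ Literature.Probability.RandomPlanarGeometry.CurveClass.simple}).toReal / (2 * Real.pi) ^ N; let μ : ℝ := ⨅ N :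 ℕ, Z (N + 1) ^ (1 / ((N : ℝ) + 1)); let V : (N : ℕ) → ℂ × (Fin N → ℝ) → Literature.Probability.RandomPlanarGeometry.CurveClass ℂ := fun N p => C N (fun k => p.1 + (ℓ : ℂ) * S N p.2 k); let E : Set (Literature.Probability.RandomPlanarGeometry.CurveClass ℂ) := {c | c ∈ Literature.Probability.RandomPlanarGeometry.CurveClass.simple ∧ c.range ⊆ closure Ω ∧ c.target ∈ Metric.ball y ℓ}; let W : MeasureTheory.Measure (Literature.Probability.RandomPlanarGeometry.CurveClass ℂ) := MeasureTheory.Measure.sum fun N : ℕ => ENNReal.ofReal ((μ⁻¹ / (2 * Real.pi)) ^ N) • ((((MeasureTheory.volume.restrict (Metric.ball x ℓ)).prod (MeasureTheory.volume.restrict (Set.univ.pi fun _ : Fin N => Set.Ico (0 : ℝ) (2 * Real.pi)))).restrict (V N ⁻¹' E)).map (V N)); (W Set.univ)⁻¹ • W); ∀ P : Literature.Probability.RandomPlanarGeometry.ChordalFamily, P.IsChordal → (∀ D : Literature.Probability.RandomPlanarGeometry.DobrushinDomain, ∃ a' b' : ℝ → ℂ, (Filter.Tendsto a' (nhdsWithin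 0 (Set.Ioi 0)) (nhds (D.pt 0)) ∧ Filter.Tendsto b' (nhdsWithin 0 (Set.Ioi 0)) (nhds (D.pt 1)) ∧ ∀ᶠ ℓ in nhdsWithin 0 (Set.Ioi 0), MeasureTheory.IsProbabilityMeasure (fjc ℓ D.carrier (a' ℓ) (b' ℓ)))) → (∀ (D : Literature.Probability.RandomPlanarGeometry.DobrushinDomain) (a' b' : ℝ → ℂ), (Filter.Tendsto a' (nhdsWithin 0 (Set.Ioi 0)) (nhds (D.pt 0)) ∧ Filter.Tendsto b' (nhdsWithin 0 (Set.Ioi 0)) (nhds (D.pt 1)) ∧ ∀ᶠ ℓ in nhdsWithin 0 (Set.Ioi 0), MeasureTheory.IsProbabilityMeasure (fjc ℓ D.carrier (a' ℓ) (b' ℓ))) → Literature.Probability.RandomPlanarGeometry.TendstoLaw (fun (_ : ℝ) (c : Literature.Probability.RandomPlanarGeometry.CurveClass ℂ) => c) (fun ℓ => fjc ℓ D.carrier (a' ℓ) (b' ℓ)) id (P D)) → ∀ D : Literature.Probability.RandomPlanarGeometry.DobrushinDomain, ∀ᵐ γ ∂(P D), γ ∈ Literature.Probability.RandomPlanarGeometry.CurveClass.simple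 ∧ γ.range ∩ frontier D.carrier ⊆ {D.pt 0, D.pt 1}

theorem anchorExactSymmetriesStmt_holds : AnchorExactSymmetriesStmt := stub_anchorExactSymmetries
theorem anchorRestrictionStmt_holds : AnchorRestrictionStmt := stub_anchorRestriction
theorem anchorMarkovKernelStmt_holds : AnchorMarkovKernelStmt := stub_anchorMarkovKernel
theorem anchorSimpleBoundaryStmt_holds : AnchorSimpleBoundaryStmt := stub_anchorSimpleBoundary

/-- X1 IS `Sym fjc`. -/
theorem anchorExactSymmetriesStmt_iff : AnchorExactSymmetriesStmt ↔ Sym fjc := Iff.rfl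
/-- X2 IS the generic restriction piece at `fjc`. -/
theorem anchorRestrictionStmt_iff :
    AnchorRestrictionStmt ↔ ∀ P : ChordalFamily, P.IsChordal → Approx fjc → Lim fjc P → P.IsRestriction :=
  Iff.rfl
/-- X3 IS the generic kernel piece at `fjc`. -/
theorem anchorMarkovKernelStmt_iff :
    AnchorMarkovKernelStmt ↔ ∀ P : ChordalFamily, P.IsChordal → Approx fjc → Lim fjc P →
      P.IsRestriction → SimpleBd P → P.IsRestrictionMarkov :=
  Iff.rfl
/-- X4 IS the generic simplicity piece at `fjc`. -/
theorem anchorSimpleBoundaryStmt_iff :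
    AnchorSimpleBoundaryStmt ↔ ∀ P : ChordalFamily, P.IsChordal → Approx fjc → Lim fjc P → SimpleBd P :=
  Iff.rfl

namespace __Registered

/-- Alias keyed by the registered stub name. -/
abbrev stub_anchorExactSymmetries : Prop := AnchorExactSymmetriesStmt
/-- Alias keyed by the registered stub name. -/
abbrev stub_anchorRestriction : Prop := AnchorRestrictionStmt
/-- Alias keyed by the registered stub name. -/
abbrev stub_anchorMarkovKernel : Prop := AnchorMarkovKernelStmt
/-- Alias keyed by the registered stub name. -/
abbrev stub_anchorSimpleBoundary : Prop := AnchorSimpleBoundaryStmt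

end __Registered

/-! ### The skeleton theorem = the split glue (no `sorry` of its own): the four children imply the crux, BY NAME -/

/-- **`AnchorAxiomsOfLimit` from its four split children** (kernel-checked; hypotheses = the children's
statements verbatim under their registered stub names; conclusion = the route decl by name): the generic
assembly `axioms_of_pieces` at `F := fjc` — (2) reversibility, (3) full similarity covariance and
(4) conjugation covariance are DERIVED from the finite-`ℓ` symmetries X1 through the identification
principle; (1) is X3 fed X2 and X4; (5) is X4. [folklore] -/
theorem AnchorAxiomsOfLimit_of (h₁ : __Registered.stub_anchorExactSymmetries)
    (h₂ : __Registered.stub_anchorRestriction) (h₃ : __Registered.stub_anchorMarkovKernel)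
    (h₄ : __Registered.stub_anchorSimpleBoundary) :
    Summit.CriticalPhenomena.SAWScalingLimit.Theses.SAWIsotropicAnchor.AnchorAxiomsOfLimit :=
  anchorAxiomsOfLimit_iff.2
    (axioms_of_pieces (F := fjc) (anchorExactSymmetriesStmt_iff.1 h₁) (anchorRestrictionStmt_iff.1 h₂)
      (anchorMarkovKernelStmt_iff.1 h₃) (anchorSimpleBoundaryStmt_iff.1 h₄))

/-- Wiring check: the registered stubs feed the skeleton theorem as stated. -/
example : Summit.CriticalPhenomena.SAWScalingLimit.Theses.SAWIsotropicAnchor.AnchorAxiomsOfLimit :=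
  AnchorAxiomsOfLimit_of stub_anchorExactSymmetries stub_anchorRestriction stub_anchorMarkovKernel
    stub_anchorSimpleBoundary

/-- **Glue shape** (the type of the route's glue item `AnchorExactSymmetries → AnchorRestriction →
AnchorMarkovKernel → AnchorSimpleBoundary → AnchorAxiomsOfLimit` created by `route edit --split`): the
children's statements, spelled out verbatim, imply the crux. -/
example
    (h₁ : let fjc : ℝ → Set ℂ → ℂ → ℂ → MeasureTheory.Measure (Literature.Probability.RandomPlanarGeometry.CurveClass ℂ) := fun ℓ Ω x y => (let S : (N : ℕ) → (Fin N → ℝ) → Fin (N + 1) → ℂ := fun N θ k => ∑ j : Fin N, if (j : ℕ) < (k : ℕ) then Complex.exp (Complex.I * (θ j : ℂ)) else 0; let C : (N : ℕ) → (Fin (N + 1) → ℂ) → Literature.Probability.RandomPlanarGeometry.CurveClass ℂ := fun _ v => Literature.Probability.RandomPlanarGeometry.CurveClass.mk ⟨Literature.Probability.LatticeModels.polyline (List.ofFn v)⟩; let Z : ℕ → ℝ := fun N => ((MeasureTheory.volume : MeasureTheory.Measure (Fin N → ℝ)) {θ | (∀ j, θ j ∈ Set.Ico (0 : ℝ) (2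 * Real.pi)) ∧ C N (S N θ) ∈ Literature.Probability.RandomPlanarGeometry.CurveClass.simple}).toReal / (2 * Real.pi) ^ N; let μ : ℝ := ⨅ N : ℕ, Z (N + 1) ^ (1 / ((N : ℝ) + 1)); let V : (N : ℕ) → ℂ × (Fin N → ℝ) → Literature.Probability.RandomPlanarGeometry.CurveClass ℂ := fun N p => C N (fun k => p.1 + (ℓ : ℂ) * S N p.2 k); let E : Set (Literature.Probability.RandomPlanarGeometry.CurveClass ℂ) := {c | c ∈ Literature.Probability.RandomPlanarGeometry.CurveClass.simple ∧ c.range ⊆ closure Ω ∧ c.target ∈ Metric.ball y ℓ}; let W : MeasureTheory.Measure (Literature.Probability.RandomPlanarGeometry.CurveClass ℂ) := MeasureTheory.Measure.sum fun N : ℕ => ENNReal.ofReal ((μ⁻¹ / (2 * Real.pi)) ^ N) • ((((MeasureTheory.volume.restrict (Metric.ball x ℓ)).prod (MeasureTheory.volume.restrict (Set.univ.pi fun _ : Fin N => Set.Ico (0 : ℝ) (2 * Real.pi)))).restrict (V N ⁻¹' E)).map (V N)); (W Set.univ)⁻¹ • W); (∀ (ℓ : ℝ) (Ω : Set ℂ)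 (x y c : ℂ) (hc : c ≠ 0) (w : ℂ), 0 < ℓ → (fjc ℓ Ω x y).map (Literature.Probability.RandomPlanarGeometry.CurveClass.map (Literature.Probability.RandomPlanarGeometry.similarity c hc w : C(ℂ, ℂ))) = fjc (‖c‖ * ℓ) (Literature.Probability.RandomPlanarGeometry.similarity c hc w '' Ω) (Literature.Probability.RandomPlanarGeometry.similarity c hc w x) (Literature.Probability.RandomPlanarGeometry.similarity c hc w y)) ∧ (∀ (ℓ : ℝ) (Ω : Set ℂ) (x y : ℂ), 0 < ℓ → (fjc ℓ Ω x y).map (Literature.Probability.RandomPlanarGeometry.CurveClass.map (Complex.conjLIE.toHomeomorph : C(ℂ, ℂ))) = fjc ℓ (Complex.conjLIE.toHomeomorph '' Ω) (Complex.conjLIE.toHomeomorph x) (Complex.conjLIE.toHomeomorph y)) ∧ (∀ (ℓ : ℝ) (Ω : Set ℂ) (x y : ℂ), 0 < ℓ → (fjc ℓ Ω x y).map Literature.Probability.RandomPlanarGeometry.CurveClass.reverse = fjc ℓ Ω y x))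
    (h₂ : let fjc : ℝ → Set ℂ → ℂ → ℂ → MeasureTheory.Measure (Literature.Probability.RandomPlanarGeometry.CurveClass ℂ) := fun ℓ Ω x y => (let S : (N : ℕ) → (Fin N → ℝ) → Fin (N + 1) → ℂ := fun N θ k => ∑ j : Fin N, if (j : ℕ) < (k : ℕ) then Complex.exp (Complex.I * (θ j : ℂ)) else 0; let C : (N : ℕ) → (Fin (N + 1) → ℂ) → Literature.Probability.RandomPlanarGeometry.CurveClass ℂ := fun _ v => Literature.Probability.RandomPlanarGeometry.CurveClass.mk ⟨Literature.Probability.LatticeModels.polyline (List.ofFn v)⟩; let Z : ℕ → ℝ := fun N => ((MeasureTheory.volume : MeasureTheory.Measure (Fin N → ℝ)) {θ | (∀ j, θ j ∈ Set.Ico (0 : ℝ) (2 * Real.pi)) ∧ C N (S N θ) ∈ Literature.Probability.RandomPlanarGeometry.CurveClass.simple}).toReal / (2 * Real.pi) ^ N; let μ : ℝ := ⨅ N : ℕ, Z (N + 1) ^ (1 / ((N : ℝ) + 1)); let V : (N : ℕ) → ℂ × (Fin N → ℝ) → Literature.Probability.RandomPlanarGeometry.CurveClass ℂ := fun N p =>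 C N (fun k => p.1 + (ℓ : ℂ) * S N p.2 k); let E : Set (Literature.Probability.RandomPlanarGeometry.CurveClass ℂ) := {c | c ∈ Literature.Probability.RandomPlanarGeometry.CurveClass.simple ∧ c.range ⊆ closure Ω ∧ c.target ∈ Metric.ball y ℓ}; let W : MeasureTheory.Measure (Literature.Probability.RandomPlanarGeometry.CurveClass ℂ) := MeasureTheory.Measure.sum fun N : ℕ => ENNReal.ofReal ((μ⁻¹ / (2 * Real.pi)) ^ N) • ((((MeasureTheory.volume.restrict (Metric.ball x ℓ)).prod (MeasureTheory.volume.restrict (Set.univ.pi fun _ : Fin N => Set.Ico (0 : ℝ) (2 * Real.pi)))).restrict (V N ⁻¹' E)).map (V N)); (W Set.univ)⁻¹ • W); ∀ P : Literature.Probability.RandomPlanarGeometry.ChordalFamily, P.IsChordal → (∀ D : Literature.Probability.RandomPlanarGeometry.DobrushinDomain, ∃ a' b' : ℝ → ℂ, (Filter.Tendsto a' (nhdsWithin 0 (Set.Ioi 0)) (nhds (D.pt 0)) ∧ Filter.Tendsto b' (nhdsWithin 0 (Set.Ioi 0)) (nhds (D.pt 1)) ∧ ∀ᶠ ℓ in nhdsWithin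 0 (Set.Ioi 0), MeasureTheory.IsProbabilityMeasure (fjc ℓ D.carrier (a' ℓ) (b' ℓ)))) → (∀ (D : Literature.Probability.RandomPlanarGeometry.DobrushinDomain) (a' b' : ℝ → ℂ), (Filter.Tendsto a' (nhdsWithin 0 (Set.Ioi 0)) (nhds (D.pt 0)) ∧ Filter.Tendsto b' (nhdsWithin 0 (Set.Ioi 0)) (nhds (D.pt 1)) ∧ ∀ᶠ ℓ in nhdsWithin 0 (Set.Ioi 0), MeasureTheory.IsProbabilityMeasure (fjc ℓ D.carrier (a' ℓ) (b' ℓ))) → Literature.Probability.RandomPlanarGeometry.TendstoLaw (fun (_ : ℝ) (c : Literature.Probability.RandomPlanarGeometry.CurveClass ℂ) => c) (fun ℓ => fjc ℓ D.carrier (a' ℓ) (b' ℓ)) id (P D)) → P.IsRestriction)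
    (h₃ : let fjc : ℝ → Set ℂ → ℂ → ℂ → MeasureTheory.Measure (Literature.Probability.RandomPlanarGeometry.CurveClass ℂ) := fun ℓ Ω x y => (let S : (N : ℕ) → (Fin N → ℝ) → Fin (N + 1) → ℂ := fun N θ k => ∑ j : Fin N, if (j : ℕ) < (k : ℕ) then Complex.exp (Complex.I * (θ j : ℂ)) else 0; let C : (N : ℕ) → (Fin (N + 1) → ℂ) → Literature.Probability.RandomPlanarGeometry.CurveClass ℂ := fun _ v => Literature.Probability.RandomPlanarGeometry.CurveClass.mk ⟨Literature.Probability.LatticeModels.polyline (List.ofFn v)⟩; let Z : ℕ → ℝ := fun N => ((MeasureTheory.volume : MeasureTheory.Measure (Fin N → ℝ)) {θ | (∀ j, θ j ∈ Set.Ico (0 : ℝ) (2 * Real.pi)) ∧ C N (S N θ) ∈ Literature.Probability.RandomPlanarGeometry.CurveClass.simple}).toReal / (2 * Real.pi) ^ N; let μ : ℝ := ⨅ N : ℕ, Z (N + 1) ^ (1 / ((N : ℝ) + 1)); let V : (N : ℕ) → ℂ × (Fin N → ℝ) → Literature.Probability.RandomPlanarGeometry.CurveClass ℂ := fun N p =>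 C N (fun k => p.1 + (ℓ : ℂ) * S N p.2 k); let E : Set (Literature.Probability.RandomPlanarGeometry.CurveClass ℂ) := {c | c ∈ Literature.Probability.RandomPlanarGeometry.CurveClass.simple ∧ c.range ⊆ closure Ω ∧ c.target ∈ Metric.ball y ℓ}; let W : MeasureTheory.Measure (Literature.Probability.RandomPlanarGeometry.CurveClass ℂ) := MeasureTheory.Measure.sum fun N : ℕ => ENNReal.ofReal ((μ⁻¹ / (2 * Real.pi)) ^ N) • ((((MeasureTheory.volume.restrict (Metric.ball x ℓ)).prod (MeasureTheory.volume.restrict (Set.univ.pi fun _ : Fin N => Set.Ico (0 : ℝ) (2 * Real.pi)))).restrict (V N ⁻¹' E)).map (V N)); (W Set.univ)⁻¹ • W); ∀ P : Literature.Probability.RandomPlanarGeometry.ChordalFamily, P.IsChordal → (∀ D : Literature.Probability.RandomPlanarGeometry.DobrushinDomain, ∃ a' b' : ℝ → ℂ, (Filter.Tendsto a' (nhdsWithin 0 (Set.Ioi 0)) (nhds (D.pt 0)) ∧ Filter.Tendsto b' (nhdsWithin 0 (Set.Ioi 0)) (nhds (D.pt 1)) ∧ ∀ᶠ ℓ in nhdsWithin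 0 (Set.Ioi 0), MeasureTheory.IsProbabilityMeasure (fjc ℓ D.carrier (a' ℓ) (b' ℓ)))) → (∀ (D : Literature.Probability.RandomPlanarGeometry.DobrushinDomain) (a' b' : ℝ → ℂ), (Filter.Tendsto a' (nhdsWithin 0 (Set.Ioi 0)) (nhds (D.pt 0)) ∧ Filter.Tendsto b' (nhdsWithin 0 (Set.Ioi 0)) (nhds (D.pt 1)) ∧ ∀ᶠ ℓ in nhdsWithin 0 (Set.Ioi 0), MeasureTheory.IsProbabilityMeasure (fjc ℓ D.carrier (a' ℓ) (b' ℓ))) → Literature.Probability.RandomPlanarGeometry.TendstoLaw (fun (_ : ℝ) (c : Literature.Probability.RandomPlanarGeometry.CurveClass ℂ) => c) (fun ℓ => fjc ℓ D.carrier (a' ℓ) (b' ℓ)) id (P D)) → P.IsRestriction → (∀ D : Literature.Probability.RandomPlanarGeometry.DobrushinDomain, ∀ᵐ γ ∂(P D), γ ∈ Literature.Probability.RandomPlanarGeometry.CurveClass.simple ∧ γ.range ∩ frontier D.carrier ⊆ {D.pt 0, D.pt 1}) → P.IsRestrictionMarkov)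
    (h₄ : let fjc : ℝ → Set ℂ → ℂ → ℂ → MeasureTheory.Measure (Literature.Probability.RandomPlanarGeometry.CurveClass ℂ) := fun ℓ Ω x y => (let S : (N : ℕ) → (Fin N → ℝ) → Fin (N + 1) → ℂ := fun N θ k => ∑ j : Fin N, if (j : ℕ) < (k : ℕ) then Complex.exp (Complex.I * (θ j : ℂ)) else 0; let C : (N : ℕ) → (Fin (N + 1) → ℂ) → Literature.Probability.RandomPlanarGeometry.CurveClass ℂ := fun _ v => Literature.Probability.RandomPlanarGeometry.CurveClass.mk ⟨Literature.Probability.LatticeModels.polyline (List.ofFn v)⟩; let Z : ℕ → ℝ := fun N => ((MeasureTheory.volume : MeasureTheory.Measure (Fin N → ℝ)) {θ | (∀ j, θ j ∈ Set.Ico (0 : ℝ) (2 * Real.pi)) ∧ C N (S N θ) ∈ Literature.Probability.RandomPlanarGeometry.CurveClass.simple}).toReal / (2 * Real.pi) ^ N; let μ : ℝ := ⨅ N : ℕ, Z (N + 1) ^ (1 / ((N : ℝ) + 1)); let V : (N : ℕ) → ℂ × (Fin N → ℝ) → Literature.Probability.RandomPlanarGeometry.CurveClass ℂ := fun N p =>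 C N (fun k => p.1 + (ℓ : ℂ) * S N p.2 k); let E : Set (Literature.Probability.RandomPlanarGeometry.CurveClass ℂ) := {c | c ∈ Literature.Probability.RandomPlanarGeometry.CurveClass.simple ∧ c.range ⊆ closure Ω ∧ c.target ∈ Metric.ball y ℓ}; let W : MeasureTheory.Measure (Literature.Probability.RandomPlanarGeometry.CurveClass ℂ) := MeasureTheory.Measure.sum fun N : ℕ => ENNReal.ofReal ((μ⁻¹ / (2 * Real.pi)) ^ N) • ((((MeasureTheory.volume.restrict (Metric.ball x ℓ)).prod (MeasureTheory.volume.restrict (Set.univ.pi fun _ : Fin N => Set.Ico (0 : ℝ) (2 * Real.pi)))).restrict (V N ⁻¹' E)).map (V N)); (W Set.univ)⁻¹ • W); ∀ P : Literature.Probability.RandomPlanarGeometry.ChordalFamily, P.IsChordal → (∀ D : Literature.Probability.RandomPlanarGeometry.DobrushinDomain, ∃ a' b' : ℝ → ℂ, (Filter.Tendsto a' (nhdsWithin 0 (Set.Ioi 0)) (nhds (D.pt 0)) ∧ Filter.Tendsto b' (nhdsWithin 0 (Set.Ioi 0)) (nhds (D.pt 1)) ∧ ∀ᶠ ℓ in nhdsWithin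 0 (Set.Ioi 0), MeasureTheory.IsProbabilityMeasure (fjc ℓ D.carrier (a' ℓ) (b' ℓ)))) → (∀ (D : Literature.Probability.RandomPlanarGeometry.DobrushinDomain) (a' b' : ℝ → ℂ), (Filter.Tendsto a' (nhdsWithin 0 (Set.Ioi 0)) (nhds (D.pt 0)) ∧ Filter.Tendsto b' (nhdsWithin 0 (Set.Ioi 0)) (nhds (D.pt 1)) ∧ ∀ᶠ ℓ in nhdsWithin 0 (Set.Ioi 0), MeasureTheory.IsProbabilityMeasure (fjc ℓ D.carrier (a' ℓ) (b' ℓ))) → Literature.Probability.RandomPlanarGeometry.TendstoLaw (fun (_ : ℝ) (c : Literature.Probability.RandomPlanarGeometry.CurveClass ℂ) => c) (fun ℓ => fjc ℓ D.carrier (a' ℓ) (b' ℓ)) id (P D)) → ∀ D : Literature.Probability.RandomPlanarGeometry.DobrushinDomain, ∀ᵐ γ ∂(P D), γ ∈ Literature.Probability.RandomPlanarGeometry.CurveClass.simple ∧ γ.range ∩ frontier D.carrier ⊆ {D.pt 0, D.pt 1}) :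
    Summit.CriticalPhenomena.SAWScalingLimit.Theses.SAWIsotropicAnchor.AnchorAxiomsOfLimit :=
  AnchorAxiomsOfLimit_of h₁ h₂ h₃ h₄

end Summit.CriticalPhenomena.SAWScalingLimit.Cruxes.AnchorAxiomsOfLimit.Split

end
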